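import Summits.ValiantsHypothesis.ValiantsHypothesis.Theorems.KPlusLogSqLawTropicalBSingleGaugeTwoRowsLemmas

/-!
# Route «KPlusLogSqLaw», crux `TropicalB` (stmt-ValiantsHypothesis-19771) — THE SINGLE-GAUGE CEILING AT `m = 2` IS `4K − 8`, FOR EVERY GAUGE

HONEST FRAMING.  Helper `--supports` the crux `Summit.ValiantsHypothesis.ValiantsHypothesis.Theses.KPlusLogSqLaw.TropicalB` (item
stmt-ValiantsHypothesis-19771, route KPlusLogSqLaw, DRAFT; cell `pub-symmetroid`, seat val-sym-trop-p4 g13, 2026-08-28).  A STRUCTURE theorem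
on dominant chains of ARBITRARY designs of format `(2, K)` that are certified column-wise by ONE affine row gauge with pairwise distinct gauged
slopes (the hypotheses `hcert`, `hgen` of val-sym-trop-p5's `SingleGauge.chain_le_of_universalGauge`, THEOREM U).  Nothing here bears on
`TropicalB` in its window, `WeakLifting`, the doors, `MatrixDescartes` (stmt-ValiantsHypothesis-18050) or VP ≠ VNP.

* `chain_le_of_universalGauge_twoRows` — **such a chain has `n ≤ 4K − 8` (`K ≥ 4`)**, against THEOREM U's `(K−2)·2² + 2 = 4K − 6`, the
  single-gauge law's `m(mK − 1) = 4K − 2` and the two-row CENSUS `T(2,K) = 4K − 7` (tree, `tropRootLawAt_two_sharp`): at `m = 2` one dual regime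
  never attains the census.  `4K − 8` is DIAMOND(`K−3`)'s count at `m = 2` (`diamond_le_of_tropRootLawAt`: `a·2² + 2·2`), so this is the exact
  single-gauge ceiling on two rows — the first all-gauge instance of the located law `(K−3)m² + 2m` (val-sym-trop-p5 g11, memo
  SINGLE-GAUGE-CEILING-g11 on the item; exhaustive there for `(3,4)`, `(4,4)`, and for `m = 2`, `K ≤ 9` by this seat).
PROOF (state potential; memo HOME/val-sym-trop-p4/g13/STRUCTURE-DAY-g13.md §B2).  Let `lo` be the row with the larger `α` (its cells come first in
the common track), `x`, `y` the exponent RANKS of the classes occupied in rows `lo`, `hi`, `S = x + y`, `A = #{l : d_l − α_lo < d_y − α_hi}`,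
`B = #{l : d_l − α_hi < d_x − α_lo}`.  A step either keeps the rows (then `S` rises) or exchanges them; call an exchange CHARGED if a rank drops.
With `N = min(max(A + B − 2, S − K + 1, 0), 2K − 4)`, `Φ = 4K − 5 − S − N` drops by `≥ 1` at every step and by `≥ 2` at charged steps (a charged
step has `A + B ≥ 2`, cost `c = S − S' + 1 ≤ min(S + 1 − A − B, K − 2)`, pre-sum `S ≤ 2K − 4`, and afterwards `A' + B' ≥ S + 2` because every
column's incidence moves forward in the track), while `S` moves by `≥ 1` resp. `≥ 3 − K`; so `Ω = (K−2)Φ + (2K − 2 − S)` drops by `≥ K − 1` at every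
step, `Ω_0 ≤ (K−2)(4K−5) + 2K − 2`, `Ω_n ≥ K − 2`, whence `(K−1)·n ≤ 4K² − 12K + 10 < (K−1)(4K−7)`.  [this seat]
-/

set_option linter.dupNamespace false
set_option autoImplicit false

namespace Summit.ValiantsHypothesis.ValiantsHypothesis.Theorems.KPlusLogSqLaw

open Summit.ValiantsHypothesis.ValiantsHypothesis.Theorems.MatrixDescartes.Negative
open scoped BigOperators
open Finset

namespace SingleGauge

namespace TwoRows

variable {K : ℕ}

/-! ## 6. The theorem -/

/-- core form: the rows are named `lo` (larger `α`) and `hi`. -/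
theorem chain_le_of_universalGauge_twoRows_core (d : Fin K → ℕ) (v ε : Fin 2 → Fin 2 → Fin K → ℤ) (α β : Fin 2 → ℚ)
    (hgen : ∀ (i i' : Fin 2) (l l' : Fin K), (d l : ℚ) - α i = (d l' : ℚ) - α i' → i = i' ∧ l = l')
    (lo hi : Fin 2) (hlh : lo ≠ hi) (hα : α hi < α lo) (hK : 4 ≤ K)
    {n : ℕ} (θ : Fin (n + 1) → ℤ) (hθ : StrictMono θ) (p : Fin (n + 1) → Equiv.Perm (Fin 2) × (Fin 2 → Fin K))
    (hdom : ∀ k, IsDominant d v ε (θ k) (p k)) (hne : ∀ k : Fin n, p k.castSucc ≠ p k.succ)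
    (hcert : ∀ (k : Fin (n + 1)) (j i : Fin 2) (l : Fin K), ε i j l ≠ 0 →
      ((θ k : ℚ) * (d l : ℚ) - (v i j l : ℚ)) - (α i * (θ k : ℚ) + β i) ≤
        ((θ k : ℚ) * (d ((p k).2 j) : ℚ) - (v ((p k).1 j) j ((p k).2 j) : ℚ)) - (α ((p k).1 j) * (θ k : ℚ) + β ((p k).1 j))) :
    (n : ℤ) + 8 ≤ 4 * K := by
  have hdinj : Function.Injective d := fun l l' h => (hgen lo lo l l' (by rw [h])).2
  have hK4 : (4 : ℤ) ≤ (K : ℤ) := by exact_mod_cast hK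
  have hne' : ∀ l l' : Fin K, (d l : ℚ) - α lo ≠ (d l' : ℚ) - α hi := fun l l' h => hlh (hgen _ _ _ _ h).1
  -- the quantities of a term
  let rk : Fin K → ℕ := fun c => (univ.filter fun l => d l < d c).card
  let cl : (Equiv.Perm (Fin 2) × (Fin 2 → Fin K)) → Fin 2 → Fin K := fun q r => q.2 (q.1.symm r)
  let Ac : (Equiv.Perm (Fin 2) × (Fin 2 → Fin K)) → ℕ := fun q =>
    (univ.filter fun l => (d l : ℚ) - α lo < (d (cl q hi) : ℚ) - α hi).card
  let Bc : (Equiv.Perm (Fin 2) × (Fin 2 → Fin K)) → ℕ := fun q =>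
    (univ.filter fun l => (d l : ℚ) - α hi < (d (cl q lo) : ℚ) - α lo).card
  let S : (Equiv.Perm (Fin 2) × (Fin 2 → Fin K)) → ℤ := fun q => (rk (cl q lo) : ℤ) + (rk (cl q hi) : ℤ)
  let N : (Equiv.Perm (Fin 2) × (Fin 2 → Fin K)) → ℤ := fun q =>
    min (max (max ((Ac q : ℤ) + (Bc q : ℤ) - 2) (S q - K + 1)) 0) (2 * K - 4)
  let Ω : (Equiv.Perm (Fin 2) × (Fin 2 → Fin K)) → ℤ := fun q =>
    ((K : ℤ) - 2) * (4 * K - 5 - S q - N q) + (2 * K - 2 - S q)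
  -- bounds of `Ω`
  have rk_le : ∀ c : Fin K, (rk c : ℤ) ≤ (K : ℤ) - 1 := fun c => by
    have h' : ((univ.filter fun l => d l < d c).card : ℤ) + 1 ≤ K := by exact_mod_cast rank_lt_K d c
    show ((univ.filter fun l => d l < d c).card : ℤ) ≤ K - 1
    linarith
  have hΩb : ∀ q, Ω q ≤ ((K : ℤ) - 2) * (4 * K - 5) + (2 * K - 2) ∧ (K : ℤ) - 2 ≤ Ω q := fun q => by
    have hS0 : 0 ≤ S q := by
      show (0 : ℤ) ≤ (rk (cl q lo) : ℤ) + (rk (cl q hi) : ℤ); positivity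
    have hS : S q ≤ 2 * (K : ℤ) - 2 := by
      show (rk (cl q lo) : ℤ) + (rk (cl q hi) : ℤ) ≤ 2 * K - 2
      linarith [rk_le (cl q lo), rk_le (cl q hi)]
    have hN0 : 0 ≤ N q := le_min (le_max_right _ _) (by linarith)
    have hN : N q ≤ 2 * (K : ℤ) - 4 := min_le_right _ _
    exact arith_bounds K hK (S q) (N q) hS0 hS hN0 hN
  -- the two tails of a step, in the currency of `Ω`
  have tailNC : ∀ qa qb, d (cl qa lo) ≤ d (cl qb lo) → d (cl qa hi) ≤ d (cl qb hi) → S qa + 1 ≤ S qb →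
      Ω qb + ((K : ℤ) - 1) ≤ Ω qa := by
    intro qa qb h1 h2 h3
    have hA : (Ac qa : ℤ) ≤ Ac qb := by exact_mod_cast cross_mono d (α lo) (α hi) h2
    have hB : (Bc qa : ℤ) ≤ Bc qb := by exact_mod_cast cross_mono d (α hi) (α lo) h1
    have hN : N qa ≤ N qb :=
      min_le_min (max_le_max (max_le_max (by linarith) (by linarith)) le_rfl) le_rfl
    exact arith_step_nc K hK (S qa) (S qb) (N qa) (N qb) h3 hN
  have tailCH : ∀ qa qb, ((d (cl qa lo) : ℚ) - α lo < (d (cl qb hi) : ℚ) - α hi) →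
      ((d (cl qa hi) : ℚ) - α hi < (d (cl qb lo) : ℚ) - α lo) →
      (rk (cl qb lo) < rk (cl qa lo) ∨ rk (cl qb hi) < rk (cl qa hi)) → Ω qb + ((K : ℤ) - 1) ≤ Ω qa := by
    intro qa qb X1 X2 hch
    obtain ⟨E1, E2, E3, E4, hAB, hcost, hS24⟩ :=
      charged_facts d hdinj (α lo) (α hi) hα hne' (cl qa lo) (cl qa hi) (cl qb lo) (cl qb hi) X1 X2 hch
    have e1 : (Ac qa : ℤ) ≤ rk (cl qb lo) := by exact_mod_cast E1
    have e2 : (Bc qa : ℤ) ≤ rk (cl qb hi) := by exact_mod_cast E2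
    have e3 : (rk (cl qa lo) : ℤ) + 1 ≤ Ac qb := by exact_mod_cast E3
    have e4 : (rk (cl qa hi) : ℤ) + 1 ≤ Bc qb := by exact_mod_cast E4
    have eAB : (2 : ℤ) ≤ (Ac qa : ℤ) + Bc qa := by exact_mod_cast hAB
    have ecost : (rk (cl qa lo) : ℤ) + rk (cl qa hi) + 3 ≤ (rk (cl qb lo) : ℤ) + rk (cl qb hi) + K := by exact_mod_cast hcost
    have eS24 : (rk (cl qa lo) : ℤ) + rk (cl qa hi) + 4 ≤ 2 * K := by exact_mod_cast hS24
    have hSa : S qa = (rk (cl qa lo) : ℤ) + rk (cl qa hi) := rfl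
    have hSb : S qb = (rk (cl qb lo) : ℤ) + rk (cl qb hi) := rfl
    have hNb : S qa ≤ N qb := le_min (le_max_of_le_left (le_max_of_le_left (by linarith))) (by linarith)
    have hNa : N qa ≤ S qb - 2 :=
      (min_le_left _ _).trans (max_le (max_le (by linarith) (by linarith)) (by linarith))
    exact arith_step_ch K hK (S qa) (S qb) (N qa) (N qb) (by linarith) (by linarith)
  -- THE STEP
  have hstep : ∀ k : Fin n, Ω (p k.succ) + ((K : ℤ) - 1) ≤ Ω (p k.castSucc) := by
    intro k
    set a := k.castSucc with ha
    set b := k.succ with hb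
    have hab : (θ a : ℚ) < (θ b : ℚ) := by exact_mod_cast hθ (Fin.castSucc_lt_succ (i := k))
    -- per-column monotonicity of the gauged slope (the single-gauge mechanism)
    have hmono : ∀ j, (d ((p a).2 j) : ℚ) - α ((p a).1 j) ≤ (d ((p b).2 j) : ℚ) - α ((p b).1 j) := by
      intro j
      have e1 := eps_ne_zero_of_isDominant (hdom a) j
      have e2 := eps_ne_zero_of_isDominant (hdom b) j
      have c1 := hcert a j ((p b).1 j) ((p b).2 j) e2
      have c2 := hcert b j ((p a).1 j) ((p a).2 j) e1
      nlinarith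
    have hstrict : ∀ j, ((p a).1 j ≠ (p b).1 j ∨ (p a).2 j ≠ (p b).2 j) →
        (d ((p a).2 j) : ℚ) - α ((p a).1 j) < (d ((p b).2 j) : ℚ) - α ((p b).1 j) := by
      intro j hch
      refine lt_of_le_of_ne (hmono j) fun heq => ?_
      obtain ⟨h1, h2⟩ := hgen _ _ _ _ heq
      rcases hch with h | h
      · exact h h1
      · exact h h2
    have hjlo : (p a).1 ((p a).1.symm lo) = lo := Equiv.apply_symm_apply _ _
    have hjhi : (p a).1 ((p a).1.symm hi) = hi := Equiv.apply_symm_apply _ _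
    by_cases hperm : (p a).1 = (p b).1
    · -- same rows: both classes weakly rise, one strictly
      have eq_lo : (p b).1.symm lo = (p a).1.symm lo := by rw [← hperm]
      have eq_hi : (p b).1.symm hi = (p a).1.symm hi := by rw [← hperm]
      have mlo := hmono ((p a).1.symm lo)
      have mhi := hmono ((p a).1.symm hi)
      rw [← hperm, hjlo] at mlo
      rw [← hperm, hjhi] at mhi
      have dlo : d (cl (p a) lo) ≤ d (cl (p b) lo) := by
        show d ((p a).2 ((p a).1.symm lo)) ≤ d ((p b).2 ((p b).1.symm lo))
        rw [eq_lo]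
        have : ((d ((p a).2 ((p a).1.symm lo)) : ℕ) : ℚ) ≤ d ((p b).2 ((p a).1.symm lo)) := by linarith
        exact_mod_cast this
      have dhi : d (cl (p a) hi) ≤ d (cl (p b) hi) := by
        show d ((p a).2 ((p a).1.symm hi)) ≤ d ((p b).2 ((p b).1.symm hi))
        rw [eq_hi]
        have : ((d ((p a).2 ((p a).1.symm hi)) : ℕ) : ℚ) ≤ d ((p b).2 ((p a).1.symm hi)) := by linarith
        exact_mod_cast this
      have hcls : (p a).2 ≠ (p b).2 := fun h => hne k (Prod.ext hperm h)
      obtain ⟨j, hj⟩ : ∃ j, (p a).2 j ≠ (p b).2 j := by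
        by_contra hall
        push Not at hall
        exact hcls (funext hall)
      have sj := hstrict j (Or.inr hj)
      have mlo' : (rk (cl (p a) lo) : ℤ) ≤ rk (cl (p b) lo) := by exact_mod_cast rank_mono d dlo
      have mhi' : (rk (cl (p a) hi) : ℤ) ≤ rk (cl (p b) hi) := by exact_mod_cast rank_mono d dhi
      have hS : S (p a) + 1 ≤ S (p b) := by
        show (rk (cl (p a) lo) : ℤ) + (rk (cl (p a) hi) : ℤ) + 1 ≤ (rk (cl (p b) lo) : ℤ) + (rk (cl (p b) hi) : ℤ)
        rcases fin_two_eq_or lo hi hlh ((p a).1 j) with hr | hr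
        · have hjj : (p a).1.symm lo = j := by rw [← hr, Equiv.symm_apply_apply]
          rw [← hperm, hr] at sj
          have hdlt : d ((p a).2 j) < d ((p b).2 j) := by
            have : ((d ((p a).2 j) : ℕ) : ℚ) < d ((p b).2 j) := by linarith
            exact_mod_cast this
          have slo : rk (cl (p a) lo) + 1 ≤ rk (cl (p b) lo) := by
            show rk ((p a).2 ((p a).1.symm lo)) + 1 ≤ rk ((p b).2 ((p b).1.symm lo))
            rw [eq_lo, hjj]; exact rank_lt d hdlt
          have slo' : (rk (cl (p a) lo) : ℤ) + 1 ≤ rk (cl (p b) lo) := by exact_mod_cast slo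
          linarith
        · have hjj : (p a).1.symm hi = j := by rw [← hr, Equiv.symm_apply_apply]
          rw [← hperm, hr] at sj
          have hdlt : d ((p a).2 j) < d ((p b).2 j) := by
            have : ((d ((p a).2 j) : ℕ) : ℚ) < d ((p b).2 j) := by linarith
            exact_mod_cast this
          have shi : rk (cl (p a) hi) + 1 ≤ rk (cl (p b) hi) := by
            show rk ((p a).2 ((p a).1.symm hi)) + 1 ≤ rk ((p b).2 ((p b).1.symm hi))
            rw [eq_hi, hjj]; exact rank_lt d hdlt
          have shi' : (rk (cl (p a) hi) : ℤ) + 1 ≤ rk (cl (p b) hi) := by exact_mod_cast shi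
          linarith
      exact tailNC (p a) (p b) dlo dhi hS
    · -- ROW EXCHANGE: the column of row `lo` moves to `hi` and conversely
      have hne1 := perm_two_apply_ne _ _ hperm
      have nlo : (p b).1 ((p a).1.symm lo) ≠ lo := by
        intro h; apply hne1 ((p a).1.symm lo); rw [hjlo, h]
      have nhi : (p b).1 ((p a).1.symm hi) ≠ hi := by
        intro h; apply hne1 ((p a).1.symm hi); rw [hjhi, h]
      have hb_lo : (p b).1 ((p a).1.symm lo) = hi := (fin_two_eq_or lo hi hlh _).resolve_left nlo
      have hb_hi : (p b).1 ((p a).1.symm hi) = lo := (fin_two_eq_or lo hi hlh _).resolve_right nhi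
      have eq1 : (p b).1.symm hi = (p a).1.symm lo := by rw [← hb_lo, Equiv.symm_apply_apply]
      have eq2 : (p b).1.symm lo = (p a).1.symm hi := by rw [← hb_hi, Equiv.symm_apply_apply]
      have X1 := hstrict ((p a).1.symm lo) (Or.inl (by rw [hjlo, hb_lo]; exact hlh))
      rw [hjlo, hb_lo] at X1
      have X2 := hstrict ((p a).1.symm hi) (Or.inl (by rw [hjhi, hb_hi]; exact Ne.symm hlh))
      rw [hjhi, hb_hi] at X2
      have X1' : (d (cl (p a) lo) : ℚ) - α lo < (d (cl (p b) hi) : ℚ) - α hi := by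
        show (d ((p a).2 ((p a).1.symm lo)) : ℚ) - α lo < (d ((p b).2 ((p b).1.symm hi)) : ℚ) - α hi
        rw [eq1]; exact X1
      have X2' : (d (cl (p a) hi) : ℚ) - α hi < (d (cl (p b) lo) : ℚ) - α lo := by
        show (d ((p a).2 ((p a).1.symm hi)) : ℚ) - α hi < (d ((p b).2 ((p b).1.symm lo)) : ℚ) - α lo
        rw [eq2]; exact X2
      by_cases hch : rk (cl (p b) lo) < rk (cl (p a) lo) ∨ rk (cl (p b) hi) < rk (cl (p a) hi)
      · exact tailCH (p a) (p b) X1' X2' hch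
      · -- a non-charged exchange: ranks do not fall, and they cannot both stay
        push Not at hch
        obtain ⟨hlo', hhi'⟩ := hch
        have dlo : d (cl (p a) lo) ≤ d (cl (p b) lo) := d_le_of_rank_le d hlo'
        have dhi : d (cl (p a) hi) ≤ d (cl (p b) hi) := d_le_of_rank_le d hhi'
        have hS : S (p a) + 1 ≤ S (p b) := by
          show (rk (cl (p a) lo) : ℤ) + (rk (cl (p a) hi) : ℤ) + 1 ≤ (rk (cl (p b) lo) : ℤ) + (rk (cl (p b) hi) : ℤ)
          by_contra hcon
          push Not at hcon
          have m1 : (rk (cl (p a) lo) : ℤ) ≤ rk (cl (p b) lo) := by exact_mod_cast hlo'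
          have m2 : (rk (cl (p a) hi) : ℤ) ≤ rk (cl (p b) hi) := by exact_mod_cast hhi'
          have q1 : (rk (cl (p b) lo) : ℤ) ≤ rk (cl (p a) lo) := by linarith
          have q2 : (rk (cl (p b) hi) : ℤ) ≤ rk (cl (p a) hi) := by linarith
          have q1' : rk (cl (p b) lo) ≤ rk (cl (p a) lo) := by exact_mod_cast q1
          have q2' : rk (cl (p b) hi) ≤ rk (cl (p a) hi) := by exact_mod_cast q2
          have c1 : cl (p b) lo = cl (p a) lo := hdinj (le_antisymm (d_le_of_rank_le d q1') dlo)
          have c2 : cl (p b) hi = cl (p a) hi := hdinj (le_antisymm (d_le_of_rank_le d q2') dhi)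
          rw [c2] at X1'
          rw [c1] at X2'
          linarith
        exact tailNC (p a) (p b) dlo dhi hS
  -- telescoping and arithmetic
  have htel := potential_telescope (fun k => Ω (p k)) ((K : ℤ) - 1) hstep
  have h0 := (hΩb (p 0)).1
  have hl := (hΩb (p (Fin.last n))).2
  have hmain : (n : ℤ) * ((K : ℤ) - 1) ≤ ((K : ℤ) - 2) * (4 * K - 5) + (2 * K - 2) - ((K : ℤ) - 2) := by
    have : (fun k => Ω (p k)) (Fin.last n) + (n : ℤ) * ((K : ℤ) - 1) ≤ (fun k => Ω (p k)) 0 := htel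
    simp only [] at this
    linarith
  exact arith_final K n hK hmain

/-- **THE SINGLE-GAUGE CEILING AT `m = 2`.**  A dominant chain with distinct consecutive terms of a format-`(2, K)` design, `K ≥ 4`,
certified column-wise at every time by ONE affine row gauge (`hcert`, verbatim as in `chain_le_of_singleGauge` / THEOREM U) with pairwise
distinct gauged slopes (`hgen`), has `n ≤ 4K − 8` — the DIAMOND(`K−3`) count at `m = 2`, one below the two-row census `4K − 7`. [this seat] -/
theorem chain_le_of_universalGauge_twoRows (d : Fin K → ℕ) (v ε : Fin 2 → Fin 2 → Fin K → ℤ) (α β : Fin 2 → ℚ)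
    (hgen : ∀ (i i' : Fin 2) (l l' : Fin K), (d l : ℚ) - α i = (d l' : ℚ) - α i' → i = i' ∧ l = l')
    (hK : 4 ≤ K)
    {n : ℕ} (θ : Fin (n + 1) → ℤ) (hθ : StrictMono θ) (p : Fin (n + 1) → Equiv.Perm (Fin 2) × (Fin 2 → Fin K))
    (hdom : ∀ k, IsDominant d v ε (θ k) (p k)) (hne : ∀ k : Fin n, p k.castSucc ≠ p k.succ)
    (hcert : ∀ (k : Fin (n + 1)) (j i : Fin 2) (l : Fin K), ε i j l ≠ 0 →
      ((θ k : ℚ) * (d l : ℚ) - (v i j l : ℚ)) - (α i * (θ k : ℚ) + β i) ≤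
        ((θ k : ℚ) * (d ((p k).2 j) : ℚ) - (v ((p k).1 j) j ((p k).2 j) : ℚ)) - (α ((p k).1 j) * (θ k : ℚ) + β ((p k).1 j))) :
    n + 8 ≤ 4 * K := by
  have hK0 : 0 < K := by omega
  have hα : α 0 ≠ α 1 := by
    intro h
    have := (hgen 0 1 ⟨0, hK0⟩ ⟨0, hK0⟩ (by rw [h])).1
    exact absurd this (by decide)
  have key : (n : ℤ) + 8 ≤ 4 * K := by
    rcases lt_or_gt_of_ne hα with h01 | h10
    · exact chain_le_of_universalGauge_twoRows_core d v ε α β hgen 1 0 (by decide) h01 hK θ hθ p hdom hne hcert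
    · exact chain_le_of_universalGauge_twoRows_core d v ε α β hgen 0 1 (by decide) h10 hK θ hθ p hdom hne hcert
  exact_mod_cast key

end TwoRows

end SingleGauge

end Summit.ValiantsHypothesis.ValiantsHypothesis.Theorems.KPlusLogSqLaw
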